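import Literature.NumberTheory.LFunctions.WeilFirstPrimeDataCells
import HarnessLib

/-!
# The certified piecewise-polynomial minorant of the first-prime Weil weight

Chain assembly for the cells of `WeilFirstPrimeCells.lean` (weight
`w₂(t) = Re ψ(1/4 + it/2) − √2 log 2 cos(t log 2)` of the analytic form
`Literature.NumberTheory.LFunctions.weilFirstPrimeQuadratic`), mirroring the archimedean
minorant of `WeilPositivityMinorant.lean` (Yoshida 1992, §6, for `Re ψ(1/4 + it/2)` alone):

* `cellsGamma₂ wL cells` — the even function `γ` built from a chain of first-prime cells on
  `[0, T)` (`gammaAux₂`), `checkChain₂`, and the Boolean `checkCells₂` (chain from `0` to `T`,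
  every cell checked, and the level test `wL + (√2 log 2)⁺ ≤` certified lower bound of
  `Re ψ(1/4 + iT/2)` — beyond `T` the digamma part is monotone and the ripple is at most its
  amplitude);
* soundness `level_sub_cellsGamma₂_le` (`wL − γ(t) ≤ w₂(t)` for all real `t`),
  `cellsGamma₂_eq_zero`, the signed-`γ` bound `abs_cellsGamma₂_le_step` / `integral_abs_cellsGamma₂_mul_pow_le` (`|t| ≥ T`), boundedness, measurability;
* exact rational moments `cellsMomentQ₂` and `integral_cellsGamma₂_mul_pow`
  (`∫ γ(t) t^q dt = 2 Σ_j momentQ_j(q)` for even `q`).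

Everything here is proved; there are no named facts.

## References

* H. Yoshida, *On Hermitian forms attached to zeta functions*, Adv. Stud. Pure Math. 21 (1992), §6.
-/

noncomputable section

open Complex Filter Set MeasureTheory
open scoped Real Topology

namespace Literature.NumberTheory.LFunctions

open Literature.Analysis.ValidatedNumerics.Numerics

/-! ## The piecewise minorant built from a chain of cells -/

/-- `γ` on `[0, ∞)`: `Σ_j 1_{[u_j, v_j)}(s) (wL − σ_j(s))`. [folklore] -/
def gammaAux₂ (wL : ℚ) : List FPDCell → ℝ → ℝ
  | [], _ => 0
  | c :: cs, s => Set.indicator (Ico (c.psi.u : ℝ) c.psi.v) (fun s ↦ (wL : ℝ) - c.sigma s) s + gammaAux₂ wL cs s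

/-- The even function `γ(t) = γ_{≥0}(|t|)`; the minorant of the weight is `σ = wL − γ`. [folklore] -/
def cellsGamma₂ (wL : ℚ) (cells : List FPDCell) (t : ℝ) : ℝ :=
  gammaAux₂ wL cells |t|

/-- The cells are consecutive: `u_0 = s`, `u_{j+1} = v_j`, last `v = T`. [folklore] -/
def checkChain₂ : List FPDCell → ℚ → ℚ → Bool
  | [], s, T => decide (s = T)
  | c :: cs, s, T => decide (c.psi.u = s) && checkChain₂ cs c.psi.v T

/-- All checks of a certified minorant on `[0, T]` at level `wL`: a chain of cells from `0` to `T`,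
every cell checked, and `wL ≤` (certified lower bound of the weight at `T`). [folklore] -/
def checkCells₂ (p : ℕ) (wL T : ℚ) (mwT : ℕ) (cells : List FPDCell) : Bool :=
  checkChain₂ cells 0 T && cells.all (fun c ↦ c.check p) && decide (wL + cZeroFI.hiQ ≤ wLoQ p T mwT)

section Chain

variable {p : ℕ} {wL : ℚ}

/-- A checked chain from `s` to `T` has `s ≤ T` and all cells inside `[s, T]`. [folklore] -/
theorem chain_bounds₂ {cells : List FPDCell} {s T : ℚ} (hchain : checkChain₂ cells s T = true)
    (hall : ∀ c ∈ cells, c.check p = true) :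
    s ≤ T ∧ ∀ c ∈ cells, s ≤ c.psi.u ∧ c.psi.v ≤ T := by
  induction cells generalizing s with
  | nil =>
    simp only [checkChain₂, decide_eq_true_eq] at hchain
    exact ⟨hchain.le, fun c hc ↦ by simp at hc⟩
  | cons c cs ih =>
    simp only [checkChain₂, Bool.and_eq_true, decide_eq_true_eq] at hchain
    have hc := hall c (by simp)
    have huv := FPDCell.u_lt_v hc
    have ih' := ih hchain.2 fun c' hc' ↦ hall c' (by simp [hc'])
    refine ⟨by rw [← hchain.1]; exact huv.le.trans ih'.1, fun c' hc' ↦ ?_⟩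
    simp only [List.mem_cons] at hc'
    rcases hc' with rfl | hc'
    · exact ⟨hchain.1.ge, ih'.1⟩
    · have := ih'.2 c' hc'
      exact ⟨hchain.1 ▸ huv.le.trans this.1, this.2⟩

/-- `γ_{≥0}` vanishes off `[s, T)`. [folklore] -/
theorem gammaAux₂_eq_zero {cells : List FPDCell} {s T : ℚ} (hchain : checkChain₂ cells s T = true)
    (hall : ∀ c ∈ cells, c.check p = true) {x : ℝ} (hx : x < s ∨ (T : ℝ) ≤ x) :
    gammaAux₂ wL cells x = 0 := by
  induction cells generalizing s with
  | nil => rfl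
  | cons c cs ih =>
    have hb := chain_bounds₂ hchain hall
    simp only [checkChain₂, Bool.and_eq_true, decide_eq_true_eq] at hchain
    have hcv : (c.psi.v : ℝ) ≤ T := by exact_mod_cast (hb.2 c (by simp)).2
    have huv : (c.psi.u : ℝ) < c.psi.v := by exact_mod_cast FPDCell.u_lt_v (hall c (by simp))
    have hus : (c.psi.u : ℝ) = s := by exact_mod_cast hchain.1
    simp only [gammaAux₂]
    rw [ih hchain.2 (fun c' hc' ↦ hall c' (by simp [hc'])) ?_, add_zero, Set.indicator_of_notMem]
    · rintro ⟨h1, h2⟩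
      rcases hx with hx | hx <;> linarith
    · rcases hx with hx | hx
      · left; linarith
      · right; exact hx

/-- On `[s, T)`, `γ_{≥0}(x) = wL − σ_j(x)` for the cell containing `x`. [folklore] -/
theorem gammaAux₂_spec {cells : List FPDCell} {s T : ℚ} (hchain : checkChain₂ cells s T = true)
    (hall : ∀ c ∈ cells, c.check p = true) {x : ℝ} (h1 : (s : ℝ) ≤ x) (h2 : x < T) :
    ∃ c ∈ cells, (c.psi.u : ℝ) ≤ x ∧ x < c.psi.v ∧ gammaAux₂ wL cells x = wL - c.sigma x := by
  induction cells generalizing s with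
  | nil =>
    simp only [checkChain₂, decide_eq_true_eq] at hchain
    rw [hchain] at h1
    linarith
  | cons c cs ih =>
    simp only [checkChain₂, Bool.and_eq_true, decide_eq_true_eq] at hchain
    have hus : (c.psi.u : ℝ) = s := by exact_mod_cast hchain.1
    have hall' : ∀ c' ∈ cs, c'.check p = true := fun c' hc' ↦ hall c' (by simp [hc'])
    by_cases hxv : x < c.psi.v
    · refine ⟨c, by simp, by linarith, hxv, ?_⟩
      simp only [gammaAux₂]
      have hmem : x ∈ Ico (c.psi.u : ℝ) c.psi.v := ⟨by linarith, hxv⟩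
      rw [gammaAux₂_eq_zero hchain.2 hall' (Or.inl hxv), add_zero, Set.indicator_of_mem hmem]
    · push Not at hxv
      obtain ⟨c', hc', hr⟩ := ih hchain.2 hall' hxv
      refine ⟨c', by simp [hc'], hr.1, hr.2.1, ?_⟩
      simp only [gammaAux₂]
      rw [Set.indicator_of_notMem (fun h ↦ not_lt.2 hxv h.2), zero_add, hr.2.2]

end Chain

/-- `γ_{≥0}` is bounded. [folklore] -/
theorem exists_abs_gammaAux₂_le (wL : ℚ) (cells : List FPDCell) :
    ∃ B, ∀ x, |gammaAux₂ wL cells x| ≤ B := by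
  induction cells with
  | nil => exact ⟨0, fun x ↦ by simp [gammaAux₂]⟩
  | cons c cs ih =>
    obtain ⟨B, hB⟩ := ih
    obtain ⟨C, hC⟩ := (isCompact_Icc (a := (c.psi.u : ℝ)) (b := c.psi.v)).exists_bound_of_continuousOn
      ((continuous_const.sub c.continuous_sigma).continuousOn
        (s := Icc (c.psi.u : ℝ) c.psi.v) (f := fun s ↦ (wL : ℝ) - c.sigma s))
    refine ⟨max C 0 + B, fun x ↦ ?_⟩
    simp only [gammaAux₂]
    refine (abs_add_le _ _).trans (add_le_add ?_ (hB x))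
    by_cases hx : x ∈ Ico (c.psi.u : ℝ) c.psi.v
    · rw [Set.indicator_of_mem hx]
      have := hC x (Ico_subset_Icc_self hx)
      rw [Real.norm_eq_abs] at this
      exact this.trans (le_max_left _ _)
    · rw [Set.indicator_of_notMem hx, abs_zero]
      exact le_max_right _ _

/-- `γ` is bounded. [folklore] -/
theorem exists_abs_cellsGamma₂_le (wL : ℚ) (cells : List FPDCell) :
    ∃ B, 0 ≤ B ∧ ∀ t, |cellsGamma₂ wL cells t| ≤ B := by
  obtain ⟨B, hB⟩ := exists_abs_gammaAux₂_le wL cells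
  exact ⟨B, (abs_nonneg _).trans (hB 0), fun t ↦ hB |t|⟩

/-- `γ_{≥0}` is measurable. [folklore] -/
theorem measurable_gammaAux₂ (wL : ℚ) (cells : List FPDCell) : Measurable (gammaAux₂ wL cells) := by
  induction cells with
  | nil => exact measurable_const
  | cons c cs ih =>
    change Measurable fun s ↦
      Set.indicator (Ico (c.psi.u : ℝ) c.psi.v) (fun s ↦ (wL : ℝ) - c.sigma s) s + gammaAux₂ wL cs s
    exact ((measurable_const.sub c.continuous_sigma.measurable).indicator measurableSet_Ico).add ih

/-- `γ` is measurable. [folklore] -/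
theorem measurable_cellsGamma₂ (wL : ℚ) (cells : List FPDCell) :
    Measurable (cellsGamma₂ wL cells) :=
  (measurable_gammaAux₂ wL cells).comp continuous_abs.measurable

section Sound

variable {p : ℕ} {wL T : ℚ} {mwT : ℕ} {cells : List FPDCell}

/-- Unpacking `checkCells₂`. [folklore] -/
theorem checkCells₂_spec (h : checkCells₂ p wL T mwT cells = true) :
    checkChain₂ cells 0 T = true ∧ (∀ c ∈ cells, c.check p = true) ∧ wL + cZeroFI.hiQ ≤ wLoQ p T mwT := by
  simp only [checkCells₂, Bool.and_eq_true, List.all_eq_true, decide_eq_true_eq] at h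
  exact ⟨h.1.1, h.1.2, h.2⟩

/-- `cos(|t| L) = cos(t L)`. [folklore] -/
theorem cos_abs_mul (t L : ℝ) : Real.cos (|t| * L) = Real.cos (t * L) := by
  rcases le_or_gt 0 t with ht | ht
  · rw [abs_of_nonneg ht]
  · rw [abs_of_neg ht, neg_mul, Real.cos_neg]

/-- **Soundness of a certified first-prime minorant.**
`wL − γ(t) ≤ w₂(t) = Re ψ(1/4 + it/2) − √2 log 2 cos(t log 2)` for all real `t`. [folklore] -/
theorem level_sub_cellsGamma₂_le (h : checkCells₂ p wL T mwT cells = true) (t : ℝ) :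
    (wL : ℝ) - cellsGamma₂ wL cells t ≤
      Literature.Analysis.SpecialFunctions.reDigammaQuarter t - Real.sqrt 2 * Real.log 2 * Real.cos (t * Real.log 2) := by
  obtain ⟨hchain, hall, hwL⟩ := checkCells₂_spec h
  have hT : (0 : ℝ) ≤ T := by exact_mod_cast (chain_bounds₂ hchain hall).1
  rw [← reDigammaQuarter_abs t, ← cos_abs_mul t]
  unfold cellsGamma₂
  have hx0 : (0 : ℝ) ≤ |t| := abs_nonneg t
  rcases lt_or_ge |t| (T : ℝ) with hxT | hxT
  · obtain ⟨c, hc, hux, hxv, hval⟩ := gammaAux₂_spec hchain hall (by exact_mod_cast hx0) hxT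
    rw [hval, sub_sub_cancel]
    exact FPDCell.sigma_le (hall c hc) hux hxv.le
  · rw [gammaAux₂_eq_zero hchain hall (Or.inr hxT), sub_zero]
    have hc0 : Real.sqrt 2 * Real.log 2 ≤ (cZeroFI.hiQ : ℝ) := FI.le_hiQ mem_cZeroFI
    have hc0nn : 0 ≤ Real.sqrt 2 * Real.log 2 := by positivity
    have hcos : Real.sqrt 2 * Real.log 2 * Real.cos (|t| * Real.log 2) ≤ Real.sqrt 2 * Real.log 2 :=
      mul_le_of_le_one_right hc0nn (Real.cos_le_one _)
    have hwL' : ((wL : ℚ) : ℝ) + cZeroFI.hiQ ≤ wLoQ p T mwT := by exact_mod_cast hwL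
    calc ((wL : ℚ) : ℝ) ≤ wLoQ p T mwT - Real.sqrt 2 * Real.log 2 := by linarith
      _ ≤ Literature.Analysis.SpecialFunctions.reDigammaQuarter T - Real.sqrt 2 * Real.log 2 := by
          linarith [wLoQ_le p T mwT]
      _ ≤ Literature.Analysis.SpecialFunctions.reDigammaQuarter |t| - Real.sqrt 2 * Real.log 2 := by
          linarith [Literature.Analysis.SpecialFunctions.reDigammaQuarter_mono
            (t := |t|) (u := (T : ℝ)) (by rwa [abs_abs, abs_of_nonneg hT])]
      _ ≤ Literature.Analysis.SpecialFunctions.reDigammaQuarter |t| -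
            Real.sqrt 2 * Real.log 2 * Real.cos (|t| * Real.log 2) := by linarith

/-- `γ(t) = 0` for `|t| ≥ T`. [folklore] -/
theorem cellsGamma₂_eq_zero (h : checkCells₂ p wL T mwT cells = true) {t : ℝ} (ht : (T : ℝ) ≤ |t|) :
    cellsGamma₂ wL cells t = 0 :=
  gammaAux₂_eq_zero (checkCells₂_spec h).1 (checkCells₂_spec h).2.1 (Or.inr ht)

end Sound

/-! ## Signed `γ`: a step-function bound and its moments -/

/-- The step function `Σ_j bnd_j 1_{[u_j, v_j)}` dominating `|γ_{≥0}|`. [folklore] -/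
def stepAux (wL : ℚ) : List FPDCell → ℝ → ℝ
  | [], _ => 0
  | c :: cs, s => Set.indicator (Ico (c.psi.u : ℝ) c.psi.v) (fun _ ↦ ((c.bndQ wL : ℚ) : ℝ)) s + stepAux wL cs s

/-- `|γ_{≥0}(s)| ≤ step(s)` when all cells are checked. [folklore] -/
theorem abs_gammaAux₂_le_step {p : ℕ} {wL : ℚ} {cells : List FPDCell}
    (hall : ∀ c ∈ cells, c.check p = true) (s : ℝ) :
    |gammaAux₂ wL cells s| ≤ stepAux wL cells s := by
  induction cells with
  | nil => simp [gammaAux₂, stepAux]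
  | cons c cs ih =>
    simp only [gammaAux₂, stepAux]
    refine (abs_add_le _ _).trans (add_le_add ?_ (ih fun c' hc' ↦ hall c' (by simp [hc'])))
    by_cases hs : s ∈ Ico (c.psi.u : ℝ) c.psi.v
    · rw [Set.indicator_of_mem hs, Set.indicator_of_mem hs]
      exact FPDCell.abs_level_sub_sigma_le (hall c (by simp)) wL hs.1 hs.2.le
    · rw [Set.indicator_of_notMem hs, Set.indicator_of_notMem hs, abs_zero]

/-- `step` is bounded, nonnegative and measurable. [folklore] -/
theorem stepAux_props {p : ℕ} {wL : ℚ} {cells : List FPDCell} (hall : ∀ c ∈ cells, c.check p = true) :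
    (∃ B, ∀ s, 0 ≤ stepAux wL cells s ∧ stepAux wL cells s ≤ B) ∧ Measurable (stepAux wL cells) := by
  induction cells with
  | nil => exact ⟨⟨0, fun s ↦ by simp [stepAux]⟩, measurable_const⟩
  | cons c cs ih =>
    obtain ⟨⟨B, hB⟩, hm⟩ := ih fun c' hc' ↦ hall c' (by simp [hc'])
    have hb0 : (0 : ℝ) ≤ ((c.bndQ wL : ℚ) : ℝ) := by exact_mod_cast FPDCell.bndQ_nonneg (hall c (by simp)) wL
    refine ⟨⟨((c.bndQ wL : ℚ) : ℝ) + B, fun s ↦ ?_⟩, ?_⟩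
    · simp only [stepAux]
      by_cases hs : s ∈ Ico (c.psi.u : ℝ) c.psi.v
      · rw [Set.indicator_of_mem hs]; exact ⟨add_nonneg hb0 (hB s).1, add_le_add le_rfl (hB s).2⟩
      · rw [Set.indicator_of_notMem hs, zero_add]
        exact ⟨(hB s).1, (hB s).2.trans (by linarith)⟩
    · change Measurable fun s ↦
        Set.indicator (Ico (c.psi.u : ℝ) c.psi.v) (fun _ ↦ ((c.bndQ wL : ℚ) : ℝ)) s + stepAux wL cs s
      exact (measurable_const.indicator measurableSet_Ico).add hm

/-- The moments of the step bound: `Σ_j bnd_j (v_j^{q+1} − u_j^{q+1})/(q+1)`. [folklore] -/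
def cellsAbsMomentQ (wL : ℚ) : List FPDCell → ℕ → ℚ
  | [], _ => 0
  | c :: cs, q => c.bndQ wL * c.psi.powIntQ (q + 1) + cellsAbsMomentQ wL cs q

/-- **Moments of the step bound.** `s ↦ step(s) s^q` is integrable and
`∫ step(s) s^q ds = cellsAbsMomentQ`. [folklore] -/
theorem integral_stepAux_mul_pow {p : ℕ} {wL : ℚ} {cells : List FPDCell}
    (hall : ∀ c ∈ cells, c.check p = true) (q : ℕ) :
    Integrable (fun s ↦ stepAux wL cells s * s ^ q) ∧
      ∫ s, stepAux wL cells s * s ^ q = (cellsAbsMomentQ wL cells q : ℝ) := by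
  induction cells with
  | nil => simp [stepAux, cellsAbsMomentQ]
  | cons c cs ih =>
    obtain ⟨ihi, ihv⟩ := ih fun c' hc' ↦ hall c' (by simp [hc'])
    have huv : (c.psi.u : ℝ) ≤ c.psi.v := by exact_mod_cast (FPDCell.u_lt_v (hall c (by simp))).le
    have e : (fun s ↦ stepAux wL (c :: cs) s * s ^ q) = fun s ↦
        Set.indicator (Ico (c.psi.u : ℝ) c.psi.v) (fun s ↦ ((c.bndQ wL : ℚ) : ℝ) * s ^ q) s +
          stepAux wL cs s * s ^ q := by
      funext s
      simp only [stepAux, add_mul, Set.indicator_mul_left]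
    rw [e]
    have i1 : Integrable fun s : ℝ ↦
        Set.indicator (Ico (c.psi.u : ℝ) c.psi.v) (fun s ↦ ((c.bndQ wL : ℚ) : ℝ) * s ^ q) s := by
      rw [integrable_indicator_iff measurableSet_Ico]
      exact ((continuous_const.mul (continuous_pow q)).continuousOn.integrableOn_Icc
        (a := (c.psi.u : ℝ)) (b := c.psi.v)).mono_set Ico_subset_Icc_self
    refine ⟨i1.add ihi, ?_⟩
    rw [integral_add i1 ihi, ihv, integral_indicator measurableSet_Ico, integral_Ico_eq_integral_Ioo,
      ← integral_Ioc_eq_integral_Ioo, ← intervalIntegral.integral_of_le huv,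
      intervalIntegral.integral_const_mul, WeilCell.integral_pow_eq_powIntQ, cellsAbsMomentQ]
    push_cast
    ring

/-! ## Exact moments of the minorant -/


/-- The moments of `γ_{≥0}`: `Σ_j momentQ_j`. [folklore] -/
def cellsMomentQ₂ (wL : ℚ) : List FPDCell → ℕ → ℚ
  | [], _ => 0
  | c :: cs, q => c.momentQ wL q + cellsMomentQ₂ wL cs q

section Moments

variable {p : ℕ} {wL : ℚ}

/-- The cell integrands `1_{[u,v)} (wL − σ) s^q` are integrable. [folklore] -/
theorem integrable_indicator_cell₂ (wL : ℚ) (c : FPDCell) (q : ℕ) :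
    Integrable fun s : ℝ ↦ Set.indicator (Ico (c.psi.u : ℝ) c.psi.v)
      (fun s ↦ ((wL : ℝ) - c.sigma s) * s ^ q) s := by
  rw [integrable_indicator_iff measurableSet_Ico]
  exact (((continuous_const.sub c.continuous_sigma).mul (continuous_pow q)).continuousOn.integrableOn_Icc
    (a := (c.psi.u : ℝ)) (b := c.psi.v)).mono_set Ico_subset_Icc_self

/-- **Moments of `γ_{≥0}`.** `s ↦ γ_{≥0}(s) s^q` is integrable and `∫ γ_{≥0}(s) s^q ds = Σ_j momentQ_j`. [folklore] -/
theorem integral_gammaAux₂_mul_pow {cells : List FPDCell} (hall : ∀ c ∈ cells, c.check p = true)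
    (q : ℕ) :
    Integrable (fun s ↦ gammaAux₂ wL cells s * s ^ q) ∧
      ∫ s, gammaAux₂ wL cells s * s ^ q = (cellsMomentQ₂ wL cells q : ℝ) := by
  induction cells with
  | nil => simp [gammaAux₂, cellsMomentQ₂]
  | cons c cs ih =>
    obtain ⟨ihi, ihv⟩ := ih fun c' hc' ↦ hall c' (by simp [hc'])
    have huv : (c.psi.u : ℝ) ≤ c.psi.v := by exact_mod_cast (FPDCell.u_lt_v (hall c (by simp))).le
    have e : (fun s ↦ gammaAux₂ wL (c :: cs) s * s ^ q) = fun s ↦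
        Set.indicator (Ico (c.psi.u : ℝ) c.psi.v) (fun s ↦ ((wL : ℝ) - c.sigma s) * s ^ q) s +
          gammaAux₂ wL cs s * s ^ q := by
      funext s
      simp only [gammaAux₂, add_mul, Set.indicator_mul_left]
    rw [e]
    have i1 := integrable_indicator_cell₂ wL c q
    refine ⟨i1.add ihi, ?_⟩
    rw [integral_add i1 ihi, ihv, integral_indicator measurableSet_Ico, integral_Ico_eq_integral_Ioo,
      ← integral_Ioc_eq_integral_Ioo, ← intervalIntegral.integral_of_le huv,
      FPDCell.integral_level_sub_sigma_mul_pow, cellsMomentQ₂]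
    push_cast
    ring

variable {T : ℚ} {mwT : ℕ} {cells : List FPDCell}

/-- **Moments of `γ`.** For even `q`, `t ↦ γ(t) t^q` is integrable and
`∫ γ(t) t^q dt = 2 Σ_j momentQ_j(q)`. [folklore] -/
theorem integral_cellsGamma₂_mul_pow (h : checkCells₂ p wL T mwT cells = true) {q : ℕ} (hq : Even q) :
    Integrable (fun t ↦ cellsGamma₂ wL cells t * t ^ q) ∧
      ∫ t, cellsGamma₂ wL cells t * t ^ q = 2 * (cellsMomentQ₂ wL cells q : ℝ) := by
  obtain ⟨hchain, hall, -⟩ := checkCells₂_spec h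
  obtain ⟨hFi, hFv⟩ := integral_gammaAux₂_mul_pow hall q
  set F : ℝ → ℝ := fun s ↦ gammaAux₂ wL cells s * s ^ q with hF
  have hev : (fun t ↦ cellsGamma₂ wL cells t * t ^ q) = fun t ↦ F |t| := by
    funext t
    rw [hF, cellsGamma₂]
    simp only
    rw [hq.pow_abs]
  rw [hev]
  -- support of `F` is in `[0, T]`
  have hF0 : ∀ s, s ∉ Ici (0 : ℝ) → F s = 0 := fun s hs ↦ by
    rw [hF]
    simp only
    rw [gammaAux₂_eq_zero hchain hall (Or.inl (by simpa using hs)), zero_mul]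
  constructor
  · -- integrability of `F ∘ |·|`: bounded with compact support, measurable
    obtain ⟨B, hB⟩ := exists_abs_gammaAux₂_le wL cells
    have hT0 : (0 : ℝ) ≤ T := by exact_mod_cast (chain_bounds₂ hchain hall).1
    have hmeas : Measurable fun t ↦ F |t| := by
      rw [hF]
      exact ((measurable_gammaAux₂ wL cells).mul (measurable_id.pow_const q)).comp
        continuous_abs.measurable
    have hconst : IntegrableOn (fun _ : ℝ ↦ B * (T : ℝ) ^ q) (Icc (-(T : ℝ)) T) :=
      integrableOn_const measure_Icc_lt_top.ne
    refine Integrable.mono' ((integrable_indicator_iff measurableSet_Icc).2 hconst)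
      hmeas.aestronglyMeasurable (Eventually.of_forall fun t ↦ ?_)
    by_cases ht : |t| < T
    · have hmem : t ∈ Icc (-(T : ℝ)) T := ⟨by linarith [neg_abs_le t], by linarith [le_abs_self t]⟩
      rw [Set.indicator_of_mem hmem, hF, Real.norm_eq_abs]
      simp only
      rw [abs_mul, abs_pow, abs_abs]
      exact mul_le_mul (hB _) (pow_le_pow_left₀ (abs_nonneg t) ht.le q) (by positivity)
        ((abs_nonneg _).trans (hB 0))
    · push Not at ht
      rw [hF, Real.norm_eq_abs]
      simp only
      rw [gammaAux₂_eq_zero hchain hall (Or.inr ht), zero_mul, abs_zero]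
      exact Set.indicator_nonneg (fun _ _ ↦ by
        have := (abs_nonneg _).trans (hB 0); positivity) _
  · rw [integral_comp_abs (f := F), ← integral_Ici_eq_integral_Ioi,
      setIntegral_eq_integral_of_forall_compl_eq_zero hF0, hFv]

end Moments

/-- `Σ_j bnd_j`, a bound for `sup |γ|`. [folklore] -/
def cellsBndSumQ (wL : ℚ) : List FPDCell → ℚ
  | [] => 0
  | c :: cs => c.bndQ wL + cellsBndSumQ wL cs

/-- `step(s) ≤ Σ_j bnd_j`. [folklore] -/
theorem stepAux_le_bndSum {p : ℕ} {wL : ℚ} {cells : List FPDCell} (hall : ∀ c ∈ cells, c.check p = true)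
    (s : ℝ) : stepAux wL cells s ≤ (cellsBndSumQ wL cells : ℝ) := by
  induction cells with
  | nil => simp [stepAux, cellsBndSumQ]
  | cons c cs ih =>
    simp only [stepAux, cellsBndSumQ]
    push_cast
    refine add_le_add ?_ (ih fun c' hc' ↦ hall c' (by simp [hc']))
    have hb0 : (0 : ℝ) ≤ ((c.bndQ wL : ℚ) : ℝ) := by exact_mod_cast FPDCell.bndQ_nonneg (hall c (by simp)) wL
    by_cases hs : s ∈ Ico (c.psi.u : ℝ) c.psi.v
    · rw [Set.indicator_of_mem hs]
    · rw [Set.indicator_of_notMem hs]; exact hb0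

/-- `0 ≤ Σ_j bnd_j`. [folklore] -/
theorem cellsBndSumQ_nonneg {p : ℕ} {wL : ℚ} {cells : List FPDCell} (hall : ∀ c ∈ cells, c.check p = true) :
    (0 : ℝ) ≤ (cellsBndSumQ wL cells : ℝ) :=
  le_trans ((stepAux_props (wL := wL) hall).1.choose_spec 0).1 (stepAux_le_bndSum hall 0)

section AbsMoments

variable {p : ℕ} {wL T : ℚ} {mwT : ℕ} {cells : List FPDCell}

/-- `step` vanishes off `[s₀, T)` for a checked chain from `s₀` to `T`. [folklore] -/
theorem stepAux_eq_zero {s₀ : ℚ} (hchain : checkChain₂ cells s₀ T = true)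
    (hall : ∀ c ∈ cells, c.check p = true) {x : ℝ} (hx : x < s₀ ∨ (T : ℝ) ≤ x) :
    stepAux wL cells x = 0 := by
  induction cells generalizing s₀ with
  | nil => rfl
  | cons c cs ih =>
    have hb := chain_bounds₂ hchain hall
    simp only [checkChain₂, Bool.and_eq_true, decide_eq_true_eq] at hchain
    have hcv : (c.psi.v : ℝ) ≤ T := by exact_mod_cast (hb.2 c (by simp)).2
    have huv : (c.psi.u : ℝ) < c.psi.v := by exact_mod_cast FPDCell.u_lt_v (hall c (by simp))
    have hus : (c.psi.u : ℝ) = s₀ := by exact_mod_cast hchain.1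
    simp only [stepAux]
    rw [ih hchain.2 (fun c' hc' ↦ hall c' (by simp [hc'])) ?_, add_zero, Set.indicator_of_notMem]
    · rintro ⟨h1, h2⟩
      rcases hx with hx | hx <;> linarith
    · rcases hx with hx | hx
      · left; linarith
      · right; exact hx

/-- **Sup bound for the signed minorant.** `|γ(t)| ≤ Σ_j bnd_j` for all real `t`. [folklore] -/
theorem abs_cellsGamma₂_le_bndSum (h : checkCells₂ p wL T mwT cells = true) (t : ℝ) :
    |cellsGamma₂ wL cells t| ≤ (cellsBndSumQ wL cells : ℝ) := by
  obtain ⟨-, hall, -⟩ := checkCells₂_spec h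
  unfold cellsGamma₂
  exact (abs_gammaAux₂_le_step hall |t|).trans (stepAux_le_bndSum hall |t|)

/-- **`|γ|`-moments.** For even `q`, `t ↦ |γ(t)| t^q` is integrable and
`∫ |γ(t)| t^q dt ≤ 2 · cellsAbsMomentQ(q)`. [folklore] -/
theorem integral_abs_cellsGamma₂_mul_pow_le (h : checkCells₂ p wL T mwT cells = true) {q : ℕ}
    (hq : Even q) :
    Integrable (fun t ↦ |cellsGamma₂ wL cells t| * t ^ q) ∧
      ∫ t, |cellsGamma₂ wL cells t| * t ^ q ≤ 2 * (cellsAbsMomentQ wL cells q : ℝ) := by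
  obtain ⟨hchain, hall, -⟩ := checkCells₂_spec h
  obtain ⟨hFi, -⟩ := integral_cellsGamma₂_mul_pow h hq
  obtain ⟨⟨B, hB⟩, hSm⟩ := stepAux_props (wL := wL) hall
  obtain ⟨-, hSv⟩ := integral_stepAux_mul_pow (wL := wL) hall q
  have hT0 : (0 : ℝ) ≤ T := by exact_mod_cast (chain_bounds₂ hchain hall).1
  have hev : (fun t ↦ |cellsGamma₂ wL cells t| * t ^ q) = fun t ↦ |cellsGamma₂ wL cells t * t ^ q| := by
    funext t; rw [abs_mul, abs_pow, hq.pow_abs]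
  have hint : Integrable (fun t ↦ |cellsGamma₂ wL cells t| * t ^ q) := by rw [hev]; exact hFi.abs
  refine ⟨hint, ?_⟩
  set G : ℝ → ℝ := fun s ↦ stepAux wL cells s * s ^ q with hG
  have hG0 : ∀ s, s ∉ Ici (0 : ℝ) → G s = 0 := fun s hs ↦ by
    rw [hG]; simp only
    rw [stepAux_eq_zero hchain hall (Or.inl (by simpa using hs)), zero_mul]
  have hle : ∀ t, |cellsGamma₂ wL cells t| * t ^ q ≤ G |t| := by
    intro t
    rw [hG]; simp only
    rw [hq.pow_abs]
    refine mul_le_mul_of_nonneg_right ?_ (by rw [← hq.pow_abs]; positivity)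
    unfold cellsGamma₂
    exact abs_gammaAux₂_le_step hall |t|
  -- integrability of `G ∘ |·|`: bounded with support in `[-T, T]`
  have hB0 : 0 ≤ B := (hB 0).1.trans (hB 0).2
  have hmeas : Measurable fun t ↦ G |t| := by
    rw [hG]; exact (hSm.mul (measurable_id.pow_const q)).comp continuous_abs.measurable
  have hconst : IntegrableOn (fun _ : ℝ ↦ B * (T : ℝ) ^ q) (Icc (-(T : ℝ)) T) :=
    integrableOn_const measure_Icc_lt_top.ne
  have hGi : Integrable fun t ↦ G |t| := by
    refine Integrable.mono' ((integrable_indicator_iff measurableSet_Icc).2 hconst)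
      hmeas.aestronglyMeasurable (Eventually.of_forall fun t ↦ ?_)
    by_cases ht : |t| < T
    · have hmem : t ∈ Icc (-(T : ℝ)) T := ⟨by linarith [neg_abs_le t], by linarith [le_abs_self t]⟩
      rw [Set.indicator_of_mem hmem, hG, Real.norm_eq_abs]
      simp only
      rw [abs_mul, abs_pow, abs_abs, abs_of_nonneg (hB _).1]
      exact mul_le_mul (hB _).2 (pow_le_pow_left₀ (abs_nonneg t) ht.le q) (by positivity) hB0
    · push Not at ht
      rw [hG, Real.norm_eq_abs]
      simp only
      rw [stepAux_eq_zero hchain hall (Or.inr ht), zero_mul, abs_zero]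
      exact Set.indicator_nonneg (fun _ _ ↦ by positivity) _
  have hmono := integral_mono hint hGi hle
  refine hmono.trans (le_of_eq ?_)
  rw [integral_comp_abs (f := G), ← integral_Ici_eq_integral_Ioi,
    setIntegral_eq_integral_of_forall_compl_eq_zero hG0, hSv]

end AbsMoments


end Literature.NumberTheory.LFunctions
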